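import Literature.NumberTheory.DiophantineGeometry.GenEllDeRamificationArch
import Mathlib.NumberTheory.Height.NumberField
import HarnessLib

/-!
# The ramification form `N` of `D_e`: the finite part of the height of `N(P)` is large under
# archimedean separation ([GenEll] Thm. 2.1 (ii) ⇒ (i), §3 (d) of the number-field-only plan)

S. Mochizuki, *Arithmetic elliptic curves in general position*, Math. J. Okayama Univ. **52** (2010)
[cite: MochizukiGenEll2010, Thm 2.1 p.12], proof of Thm. 2.1 (ii) ⇒ (i), kurims pp. 12–13.  PROOF-ONLY
companion of `GenEllDeRamificationArch.lean` (abc-iut cell, GenEllTwo work package W5b; route item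
`Summit.ABC.ABC.Theses.IUTThetaPilot.GenEllTwo`): the display "`(1/n)Σ_w ord_w⁺ N(P)·log N w ≥
h(N(P)) − C(r)`" of GENELLTWO-P1ROUTE §3 (d) in Mathlib's height vocabulary for number fields
(`Height.logHeight₁`, `NumberField.logHeight₁_eq`, `FinitePlace`, `InfinitePlace`):

* `sum_mult_posLog_infinitePlace_le` — the archimedean part `Σ_{v ∣ ∞} mult(v)·log⁺ (v N(x,r))⁻¹` of
  `logHeight₁ (N(x,r))⁻¹` is `≤ [K:ℚ]·log⁺ c⁻¹` when every complex conjugate `(σ x, σ r)` is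
  `ρ`-separated from the zeros of `N` on `D_e(ℂ)` (`c = c(e, ρ)` of `exists_pos_le_norm_N_of_separated`);
* `logHeight₁_sub_le_finsum_posLog` — hence `logHeight₁ (N(x,r)) − [K:ℚ]·log⁺ c⁻¹ ≤
  Σᶠ_{w finite} log⁺ (w N(x,r))⁻¹` (`logHeight₁ a⁻¹ = logHeight₁ a`; note `log⁺ (w a)⁻¹ = ord⁺_w(a)·log N w`);
* `exists_logHeight₁_le_finsum_posLog_add` — the packaged `∀ ρ > 0 ∃ C ≥ 0 ∀ K, x, r …` form.

Everything is proved; no definitions, no named facts.  Classical and undisputed; nothing here refers to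
the disputed parts of the abc-iut corpus.
-/

noncomputable section

open Real

namespace Literature.NumberTheory.DiophantineGeometry.GenEll

namespace DeArch

section HeightForm

open Height NumberField

variable {k : ℕ}

/-- ARCHIMEDEAN TERM OF THE HEIGHT, `InfinitePlace` form with multiplicities: under `ρ`-separation of
all complex conjugates, `Σ_{v ∣ ∞} mult(v)·log⁺ (v N(x,r))⁻¹ ≤ [K:ℚ]·log⁺ c⁻¹` — the archimedean part of
`logHeight₁ (N(x,r))⁻¹` in Mathlib's `NumberField.logHeight₁_eq`. [cite: MochizukiGenEll2010, Thm 2.1 p.12] -/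
theorem sum_mult_posLog_infinitePlace_le {K : Type*} [Field K] [NumberField K] {x r : K}
    (hxr : r ^ (2 * k + 1) = x * (1 - x)) {ρ c : ℝ} (hc : 0 < c)
    (h : ∀ P ∈ curve ℂ k, (∀ Q ∈ curve ℂ k, N k Q.1 Q.2 = 0 → ρ ≤ dist P Q) →
      c ≤ ‖N k P.1 P.2‖)
    (hsep : ∀ σ : K →+* ℂ, ∀ Q ∈ curve ℂ k, N k Q.1 Q.2 = 0 → ρ ≤ dist ((σ x, σ r) : ℂ × ℂ) Q) :
    ∑ v : InfinitePlace K, (v.mult : ℝ) * log⁺ (v (N k x r))⁻¹ ≤ Module.finrank ℚ K * log⁺ c⁻¹ := by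
  have hterm : ∀ v : InfinitePlace K,
      (v.mult : ℝ) * log⁺ (v (N k x r))⁻¹ ≤ (v.mult : ℝ) * log⁺ c⁻¹ := fun v =>
    mul_le_mul_of_nonneg_left (posLog_infinitePlace_le hxr hc h v (hsep v.embedding))
      (Nat.cast_nonneg _)
  calc ∑ v : InfinitePlace K, (v.mult : ℝ) * log⁺ (v (N k x r))⁻¹
      ≤ ∑ v : InfinitePlace K, (v.mult : ℝ) * log⁺ c⁻¹ := Finset.sum_le_sum fun v _ => hterm v
    _ = (∑ v : InfinitePlace K, (v.mult : ℝ)) * log⁺ c⁻¹ := by rw [Finset.sum_mul]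
    _ = Module.finrank ℚ K * log⁺ c⁻¹ := by
      rw [← Nat.cast_sum, InfinitePlace.sum_mult_eq]

/-- THE FINITE PART OF THE HEIGHT OF `N(P)` IS LARGE (GENELLTWO-P1ROUTE §3 (d): "`(1/n)Σ_w ord_w⁺ N(P)
log N w ≥ h(N(P)) − C(r)`"): for a number field `K` and `(x, r) ∈ D_e(K)` all of whose complex conjugates
are `ρ`-separated from the zeros of `N` on `D_e(ℂ)`,
`logHeight₁ (N(x,r)) − [K:ℚ]·log⁺ c⁻¹ ≤ Σᶠ_{w finite} log⁺ (w N(x,r))⁻¹`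
(and `log⁺ (w a)⁻¹ = ord⁺_w(a)·log N w`). Via `logHeight₁ a⁻¹ = logHeight₁ a` and Mathlib's
finite/archimedean decomposition `NumberField.logHeight₁_eq`. [cite: MochizukiGenEll2010, Thm 2.1 p.12] -/
theorem logHeight₁_sub_le_finsum_posLog {K : Type*} [Field K] [NumberField K] {x r : K}
    (hxr : r ^ (2 * k + 1) = x * (1 - x)) {ρ c : ℝ} (hc : 0 < c)
    (h : ∀ P ∈ curve ℂ k, (∀ Q ∈ curve ℂ k, N k Q.1 Q.2 = 0 → ρ ≤ dist P Q) →
      c ≤ ‖N k P.1 P.2‖)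
    (hsep : ∀ σ : K →+* ℂ, ∀ Q ∈ curve ℂ k, N k Q.1 Q.2 = 0 → ρ ≤ dist ((σ x, σ r) : ℂ × ℂ) Q) :
    logHeight₁ (N k x r) - Module.finrank ℚ K * log⁺ c⁻¹ ≤
      ∑ᶠ w : FinitePlace K, log⁺ (w (N k x r))⁻¹ := by
  have hdec := NumberField.logHeight₁_eq (N k x r)⁻¹
  rw [Height.logHeight₁_inv] at hdec
  have harch : ∑ v : InfinitePlace K, (v.mult : ℝ) * log⁺ (v (N k x r)⁻¹) ≤
      Module.finrank ℚ K * log⁺ c⁻¹ := by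
    simp_rw [map_inv₀]
    exact sum_mult_posLog_infinitePlace_le hxr hc h hsep
  have hfin : ∑ᶠ w : FinitePlace K, log⁺ (w (N k x r)⁻¹) = ∑ᶠ w : FinitePlace K, log⁺ (w (N k x r))⁻¹ := by
    simp_rw [map_inv₀]
  rw [← hfin]
  linarith

/-- Packaged form of `logHeight₁_sub_le_finsum_posLog`: `∀ ρ > 0 ∃ C ≥ 0` (depending only on `e`, `ρ`)
such that for every number field `K` and `(x, r) ∈ D_e(K)` with `ρ`-separated conjugates,
`logHeight₁ (N(x,r)) ≤ Σᶠ_{w finite} log⁺ (w N(x,r))⁻¹ + [K:ℚ]·C`. [cite: MochizukiGenEll2010, Thm 2.1 p.12] -/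
theorem exists_logHeight₁_le_finsum_posLog_add (k : ℕ) {ρ : ℝ} (hρ : 0 < ρ) :
    ∃ C : ℝ, 0 ≤ C ∧ ∀ (K : Type) [Field K] [NumberField K] (x r : K),
      r ^ (2 * k + 1) = x * (1 - x) →
      (∀ σ : K →+* ℂ, ∀ Q ∈ curve ℂ k, N k Q.1 Q.2 = 0 → ρ ≤ dist ((σ x, σ r) : ℂ × ℂ) Q) →
      logHeight₁ (N k x r) ≤
        (∑ᶠ w : FinitePlace K, log⁺ (w (N k x r))⁻¹) + Module.finrank ℚ K * C := by
  obtain ⟨c, hc, h⟩ := exists_pos_le_norm_N_of_separated k hρ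
  refine ⟨log⁺ c⁻¹, posLog_nonneg, fun K _ _ x r hxr hsep => ?_⟩
  have := logHeight₁_sub_le_finsum_posLog hxr hc h hsep
  linarith

end HeightForm

end DeArch

end Literature.NumberTheory.DiophantineGeometry.GenEll
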